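import Literature.AnabelianGeometry.EtaleTheta.ThetaRootOrbitsOfSetting
import Literature.AnabelianGeometry.EtaleTheta.ContH1ConjAction
import HarnessLib

/-!
# [EtTh] Cor 2.8 (iii) at the §1 model, INNER clauses: conjugation by `Π^tp_{Ẋ̲̲}` (resp. `Π^tp_{Ẋ̲}`)
# preserves `η̲̈^{Θ,l·ℤ}` (resp. `η̈^{Θ,l·ℤ}`) — for the orbit data `ThetaOrbitData.ofEmbedding`

Mochizuki, *The Étale Theta Function …* [EtTh], Publ. RIMS 45 (2009), §2, Cor 2.8 (iii), PRIMS PDF p.42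
(bib key `MochizukiEtTh2009`): "if … `γ` arises from an inner automorphism of `Π^tp_{Ẋ̲̲}` (resp. `Π^tp_{Ẋ̲}`;
`Π^tp_{Ċ̲̲}`; `Π^tp_{Ċ̲}`), then `γ` preserves `η̲̈^{Θ,l·ℤ}` (resp. `η̈^{Θ,l·ℤ}`; `η̲̈^{Θ,l·ℤ}`; `η̈^{Θ,l·ℤ}`) [i.e.,
without any constant multiple indeterminacy]".

PROOF-ONLY companion (no `def`; seat abc-iut-L2-t2, owner of `ThetaRootOrbits.lean` /
`ThetaRootOrbitsOfSetting.lean`; cell abc-iut, layer L2, merge row W3-L2-02). For the orbit data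
`ThetaCovers.ThetaOrbitData.ofEmbedding ε hC hS` built from the §1 model along an
`OrbitEmbedding ε : ι : Π^tp_X ↪ Π^tp_C = T.Gtp`, the FIRST TWO clauses of `ThetaOrbitData.Cor28_iii`
(the inner automorphisms coming from `Π^tp_X`):

* `ofEmbedding_transport_inner_rootLZ` — for `x ∈ Π^tp_{X̲̲} ∩ Π^tp_Ċ` of `T` (so `x = ι σ`,
  `σ ∈ C.Huu`) and `Γ_Θ` the automorphism of the cyclotome INDUCED by the inner automorphism `γ_x`,
  the transport `(γ_x, Γ_Θ) · η̲̈^{Θ,l·ℤ} = η̲̈^{Θ,l·ℤ}` — clause 1 of `Cor28_iii`, outright;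
* `ofEmbedding_transport_inner_etaLZ` — the same for `x ∈ Π^tp_{X̲} ∩ Π^tp_Ċ` and `η̈^{Θ,l·ℤ}`, under the
  one further identity `ι(Π^tp_{X̲}) = T.tp T.PiXu` (true at abc-iut-L2-d3's `TemperedCoverData.ofSetting`;
  not a field of `OrbitEmbedding`) — clause 2.

Mechanism (pp.41–42, "immediate from the definitions", cf. Rmk 1.9.1): on cocycle representatives the
transport by `(γ_{ισ}, Γ_Θ)` is conjugation by `σ⁻¹` (`symm_transport`:
`Γ_Θ⁻¹ ∘ F ∘ γ_{ισ} = transport (σ⁻¹ · f)`), so a transported class is the class of `σ⁻¹·x`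
(`image_classOf_eq`, `image_rootClassOf_eq`), and an orbit collection under a set `S ∋ σ^{±1}·S` of
conjugators is mapped onto itself (`image_orbitColl_eq`, `image_rootColl_eq`). Clauses 3–4 (`γ` inner
from `Π^tp_{Ċ̲̲}`, `Π^tp_{Ċ̲}` OUTSIDE `ι(Π^tp_X)`) need the action of the inversion `ι̲` on `η̈^Θ`
(abc-iut-L2-d3 census P-C5) and are not addressed. HONEST FRAMING: [EtTh] is refereed; no side is
taken on [IUTchIII] Cor 3.12; nothing beyond the displayed statements is claimed.
-/

noncomputable section

namespace Literature.AnabelianGeometry.EtaleTheta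

open Literature.AnabelianGeometry.SemiGraphs ThetaCovers

universe u

namespace ThetaSetting.EtaleThetaData.DoubleUnderline.OrbitEmbedding

variable {p : ℕ} [Fact p.Prime] {D : ThetaSetting p} {E : D.EtaleThetaData} {l : ℕ}
  {C : E.DoubleUnderline l} {T : TemperedCoverData.{u} l} (ε : C.OrbitEmbedding T)

/-! ### Conjugation by `ι σ` on `Π^tp_Ÿ`, `Π^tp_{Ÿ̲̲}` of `T` -/

/-- `ι(σ)` normalises `T.PiYddtp = ι(Π^tp_Ÿ)` (`Π^tp_Ÿ ⊴ Π^tp_X`, `Compat`).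
[cite: MochizukiEtTh2009, Def 2.7 p.41] -/
theorem conj_mem_PiYddtp [hN : D.GtpYdd.Normal] (σ : D.PiTemp) (y : ↥T.PiYddtp) :
    ε.ι σ * (y : T.Gtp) * (ε.ι σ)⁻¹ ∈ T.PiYddtp := by
  obtain ⟨g, hg, hgy⟩ := Subgroup.mem_map.1 (ε.map_GtpYdd.ge y.2)
  rw [← hgy, ← map_inv, ← map_mul, ← map_mul]
  exact ε.map_GtpYdd.le ⟨σ * g * σ⁻¹, hN.conj_mem g hg σ, rfl⟩

/-- `ι(σ)⁻¹` normalises `T.PiYddtp`. [cite: MochizukiEtTh2009, Def 2.7 p.41] -/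
theorem inv_conj_mem_PiYddtp [hN : D.GtpYdd.Normal] (σ : D.PiTemp) (y : ↥T.PiYddtp) :
    (ε.ι σ)⁻¹ * (y : T.Gtp) * ε.ι σ ∈ T.PiYddtp := by
  have h := ε.conj_mem_PiYddtp σ⁻¹ y
  rwa [map_inv, inv_inv] at h

/-- For `σ ∈ Π^tp_{X̲̲}`, `ι(σ)` normalises `Π^tp_{Ÿ̲̲} = T.PiYddtp ∩ Π^tp_{X̲̲}` of `T`.
[cite: MochizukiEtTh2009, Def 2.7 p.41] -/
theorem conj_mem_PiYdduu [hN : D.GtpYdd.Normal] {σ : D.PiTemp} (hσ : σ ∈ C.Huu)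
    (y : ↥(T.PiYddtp ⊓ T.tp T.PiXuu)) :
    ε.ι σ * (y : T.Gtp) * (ε.ι σ)⁻¹ ∈ T.PiYddtp ⊓ T.tp T.PiXuu := by
  refine Subgroup.mem_inf.2 ⟨ε.conj_mem_PiYddtp σ ⟨y, (Subgroup.mem_inf.1 y.2).1⟩, ?_⟩
  obtain ⟨g, hg, hgy⟩ := Subgroup.mem_map.1 (ε.map_Huu.ge (Subgroup.mem_inf.1 y.2).2)
  rw [← hgy, ← map_inv, ← map_mul, ← map_mul]
  exact ε.map_Huu.le ⟨σ * g * σ⁻¹, C.Huu.mul_mem (C.Huu.mul_mem hσ hg) (C.Huu.inv_mem hσ), rfl⟩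

/-- For `σ ∈ Π^tp_{X̲̲}`, `ι(σ)⁻¹` normalises `Π^tp_{Ÿ̲̲}` of `T`. [cite: MochizukiEtTh2009, Def 2.7 p.41] -/
theorem inv_conj_mem_PiYdduu [hN : D.GtpYdd.Normal] {σ : D.PiTemp} (hσ : σ ∈ C.Huu)
    (y : ↥(T.PiYddtp ⊓ T.tp T.PiXuu)) :
    (ε.ι σ)⁻¹ * (y : T.Gtp) * ε.ι σ ∈ T.PiYddtp ⊓ T.tp T.PiXuu := by
  have h := ε.conj_mem_PiYdduu (C.Huu.inv_mem hσ) y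
  rwa [map_inv, inv_inv] at h

/-- `ι⁻¹` of a conjugate: `pull (ι σ · y · ι σ⁻¹) = σ · pull(y) · σ⁻¹`. [cite: MochizukiEtTh2009, Def 2.7 p.41] -/
theorem pull_conj (σ : D.PiTemp) (y : ↥T.PiYddtp) (h : ε.ι σ * (y : T.Gtp) * (ε.ι σ)⁻¹ ∈ T.PiYddtp) :
    (ε.pull ⟨ε.ι σ * (y : T.Gtp) * (ε.ι σ)⁻¹, h⟩ : D.PiTemp) = σ * (ε.pull y : D.PiTemp) * σ⁻¹ :=
  ε.injective_ι (by rw [ε.ι_pull, map_mul, map_mul, map_inv, ε.ι_pull])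

/-! ### The induced automorphism of the cyclotome, and the transport of cocycles -/

/-- If `Γ_Θ` is INDUCED (`ThetaOrbitData.InducesOnTheta`) by the inner automorphism `γ_{ι σ}` on the
cyclotome `ι(toTheta⁻¹Δ_Θ)/ι(Ker toTheta) ≅ Δ_Θ`, then `Γ_Θ⁻¹` is conjugation by `toTheta(σ)⁻¹` on `Δ_Θ`.
[cite: MochizukiEtTh2009, Cor 2.8(i) p.42] -/
theorem symm_coeffOf_of_induces (hC : D.Compat) (hS : D.Sec2Hyps) [hb : ε.bot.Normal] (σ : D.PiTemp)
    (ΓΘ : ε.Coeff ≃* ε.Coeff)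
    (h : (ThetaOrbitData.ofEmbedding ε hC hS).InducesOnTheta (ThetaOrbitData.innerAutTop (ε.ι σ)) ΓΘ)
    (d : ↥D.DeltaTheta) :
    ΓΘ.symm (ε.coeffOf d) = ε.coeffOf (MulAut.conjNormal (D.toTheta σ⁻¹) d) := by
  obtain ⟨hΓ, hind⟩ := h
  have htop : ∀ t : ↥ε.top, ε.ι σ * (t : T.Gtp) * (ε.ι σ)⁻¹ ∈ ε.top := fun t => hΓ.le ⟨t, t.2, rfl⟩
  have hind' : ∀ t : ↥ε.top, ΓΘ (t : ε.Coeff) = ((⟨_, htop t⟩ : ↥ε.top) : ε.Coeff) := fun t => hind t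
  rw [MulEquiv.symm_apply_eq]
  set c : ↥D.DeltaTheta := MulAut.conjNormal (D.toTheta σ⁻¹) d with hc
  show ε.coeffOf d = ΓΘ (((⟨ε.ι (lift c), ε.ι_lift_mem_top c⟩ : ↥ε.top) : ε.Coeff))
  rw [hind']
  have hmem : ε.ι (σ * lift c * σ⁻¹) ∈ ε.top := by
    rw [map_mul, map_mul, map_inv]; exact htop ⟨_, ε.ι_lift_mem_top c⟩
  have hval : (⟨ε.ι σ * ((⟨ε.ι (lift c), ε.ι_lift_mem_top c⟩ : ↥ε.top) : T.Gtp) * (ε.ι σ)⁻¹,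
      htop ⟨_, ε.ι_lift_mem_top c⟩⟩ : ↥ε.top) = ⟨ε.ι (σ * lift c * σ⁻¹), hmem⟩ :=
    Subtype.ext (by simp only [map_mul, map_inv])
  rw [hval]
  refine ε.coeffOf_eq_mk ?_ hmem
  rw [map_mul, map_mul, toTheta_lift, hc, MulAut.conjNormal_apply, map_inv]
  group

/-- **Transport = conjugation by `σ⁻¹` on representatives**: for a cocycle `f` on `Π^tp_Ÿ` and
`Γ_Θ⁻¹ = conj(toTheta σ⁻¹)` on `Δ_Θ`, `Γ_Θ⁻¹(F(ι σ · y · ι σ⁻¹)) = (transport (σ⁻¹·f))(y)` where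
`F = transport f` and `(σ⁻¹·f)(g) = toTheta(σ)⁻¹ f(σ g σ⁻¹) toTheta(σ)`. [cite: MochizukiEtTh2009, Cor 2.8(iii) p.42] -/
theorem symm_transport [hN : D.GtpYdd.Normal] [hb : ε.bot.Normal] (σ : D.PiTemp)
    (ΓΘ : ε.Coeff ≃* ε.Coeff)
    (hΘ : ∀ d, ΓΘ.symm (ε.coeffOf d) = ε.coeffOf (MulAut.conjNormal (D.toTheta σ⁻¹) d))
    (f : ↥(contCocycles D.toTheta D.DeltaTheta D.GtpYdd)) (y : ↥T.PiYddtp)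
    (hy : ε.ι σ * (y : T.Gtp) * (ε.ι σ)⁻¹ ∈ T.PiYddtp) :
    ΓΘ.symm (ε.transport f.1 ⟨_, hy⟩) =
      ε.transport (ContH1.conjCocycle D.toTheta D.DeltaTheta σ⁻¹ f).1 y := by
  show ΓΘ.symm (ε.coeffOf (f.1 (ε.pull ⟨_, hy⟩))) =
    ε.coeffOf ((ContH1.conjCocycle D.toTheta D.DeltaTheta σ⁻¹ f).1 (ε.pull y))
  have hAB : ε.pull ⟨_, hy⟩ = MulAut.conjNormal σ (ε.pull y) :=
    Subtype.ext (by rw [ε.pull_conj, MulAut.conjNormal_apply])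
  rw [hΘ, ContH1.conjCocycle_apply, inv_inv, hAB]

/-- **The transported class is the class of `σ⁻¹·x`**: the image of `classOf x` under
`F ↦ Γ_Θ⁻¹ ∘ F ∘ γ_{ισ}` is `classOf (σ⁻¹·x)`. [cite: MochizukiEtTh2009, Cor 2.8(iii) p.42] -/
theorem image_classOf_eq [hN : D.GtpYdd.Normal] [hb : ε.bot.Normal] (σ : D.PiTemp)
    (ΓΘ : ε.Coeff ≃* ε.Coeff)
    (hΘ : ∀ d, ΓΘ.symm (ε.coeffOf d) = ε.coeffOf (MulAut.conjNormal (D.toTheta σ⁻¹) d))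
    (hmem : ∀ y : ↥T.PiYddtp, ε.ι σ * (y : T.Gtp) * (ε.ι σ)⁻¹ ∈ T.PiYddtp) (x : D.H1 D.GtpYdd) :
    (fun F : ↥T.PiYddtp → ε.Coeff => fun y : ↥T.PiYddtp => ΓΘ.symm (F ⟨_, hmem y⟩)) '' ε.classOf x =
      ε.classOf (ContH1.conj D.toTheta D.DeltaTheta σ⁻¹ x) := by
  ext F
  constructor
  · rintro ⟨_, ⟨f, hf, rfl⟩, rfl⟩
    refine ⟨ContH1.conjCocycle D.toTheta D.DeltaTheta σ⁻¹ f, ?_, ?_⟩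
    · rw [← hf]; exact (ContH1.conj_mk σ⁻¹ f).symm
    · funext y; exact ε.symm_transport σ ΓΘ hΘ f y (hmem y)
  · rintro ⟨f', hf', rfl⟩
    refine ⟨ε.transport (ContH1.conjCocycle D.toTheta D.DeltaTheta σ f').1,
      ⟨ContH1.conjCocycle D.toTheta D.DeltaTheta σ f', ?_, rfl⟩, ?_⟩
    · have h1 : ContH1.conj D.toTheta D.DeltaTheta σ
          (ContH1.mk f'.1 f'.2 : D.H1 D.GtpYdd) = x := by
        rw [hf', ContH1.conj_conj_inv_apply]
      rw [← h1]; exact (ContH1.conj_mk σ f').symm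
    · funext y
      show ΓΘ.symm (ε.transport (ContH1.conjCocycle D.toTheta D.DeltaTheta σ f').1 ⟨_, hmem y⟩) =
        ε.transport f'.1 y
      rw [ε.symm_transport σ ΓΘ hΘ _ y (hmem y), ← ContH1.conjCocycle_mul, inv_mul_cancel,
        ContH1.conjCocycle_one]

/-- **The transported root class is the root class of `σ⁻¹·x`** (`σ ∈ Π^tp_{X̲̲}`): the image of
`rootClassOf x` under `ξ ↦ Γ_Θ⁻¹ ∘ ξ ∘ γ_{ισ}` (on `Π^tp_{Ÿ̲̲}`) is `rootClassOf (σ⁻¹·x)`.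
[cite: MochizukiEtTh2009, Cor 2.8(iii) p.42] -/
theorem image_rootClassOf_eq [hN : D.GtpYdd.Normal] [hb : ε.bot.Normal] {σ : D.PiTemp}
    (hσ : σ ∈ C.Huu) (ΓΘ : ε.Coeff ≃* ε.Coeff)
    (hΘ : ∀ d, ΓΘ.symm (ε.coeffOf d) = ε.coeffOf (MulAut.conjNormal (D.toTheta σ⁻¹) d))
    (hmem : ∀ y : ↥T.PiYddtp, ε.ι σ * (y : T.Gtp) * (ε.ι σ)⁻¹ ∈ T.PiYddtp)
    (hmem' : ∀ g : ↥(T.PiYddtp ⊓ T.tp T.PiXuu), ε.ι σ * (g : T.Gtp) * (ε.ι σ)⁻¹ ∈ T.PiYddtp ⊓ T.tp T.PiXuu)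
    (x : D.H1 D.GtpYdd) :
    (fun ξ : ↥(T.PiYddtp ⊓ T.tp T.PiXuu) → ε.Coeff => fun g : ↥(T.PiYddtp ⊓ T.tp T.PiXuu) =>
        ΓΘ.symm (ξ ⟨_, hmem' g⟩)) '' ε.rootClassOf x =
      ε.rootClassOf (ContH1.conj D.toTheta D.DeltaTheta σ⁻¹ x) := by
  have hcl := ε.image_classOf_eq σ ΓΘ hΘ hmem x
  -- the inverse conjugation on `Π^tp_{Ÿ̲̲}` and the two "round trips"
  have hinv : ∀ g : ↥(T.PiYddtp ⊓ T.tp T.PiXuu),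
      (ε.ι σ)⁻¹ * (g : T.Gtp) * ε.ι σ ∈ T.PiYddtp ⊓ T.tp T.PiXuu := ε.inv_conj_mem_PiYdduu hσ
  have hrt : ∀ g : ↥(T.PiYddtp ⊓ T.tp T.PiXuu),
      (⟨ε.ι σ * ((⟨_, hinv g⟩ : ↥(T.PiYddtp ⊓ T.tp T.PiXuu)) : T.Gtp) * (ε.ι σ)⁻¹, hmem' ⟨_, hinv g⟩⟩ :
        ↥(T.PiYddtp ⊓ T.tp T.PiXuu)) = g := fun g =>
    Subtype.ext (by show ε.ι σ * ((ε.ι σ)⁻¹ * (g : T.Gtp) * ε.ι σ) * (ε.ι σ)⁻¹ = g; group)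
  have hrt' : ∀ g : ↥(T.PiYddtp ⊓ T.tp T.PiXuu),
      (⟨(ε.ι σ)⁻¹ * ((⟨_, hmem' g⟩ : ↥(T.PiYddtp ⊓ T.tp T.PiXuu)) : T.Gtp) * ε.ι σ, hinv ⟨_, hmem' g⟩⟩ :
        ↥(T.PiYddtp ⊓ T.tp T.PiXuu)) = g := fun g =>
    Subtype.ext (by show (ε.ι σ)⁻¹ * (ε.ι σ * (g : T.Gtp) * (ε.ι σ)⁻¹) * ε.ι σ = g; group)
  have hrtY : ∀ g : ↥(T.PiYddtp ⊓ T.tp T.PiXuu),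
      (⟨ε.ι σ * ((⟨_, hinv g⟩ : ↥(T.PiYddtp ⊓ T.tp T.PiXuu)) : T.Gtp) * (ε.ι σ)⁻¹,
          hmem ⟨_, (Subgroup.mem_inf.1 (hinv g)).1⟩⟩ : ↥T.PiYddtp) =
        ⟨g, (Subgroup.mem_inf.1 g.2).1⟩ := fun g =>
    Subtype.ext (by show ε.ι σ * ((ε.ι σ)⁻¹ * (g : T.Gtp) * ε.ι σ) * (ε.ι σ)⁻¹ = g; group)
  ext ξ'
  constructor
  · rintro ⟨ξ, ⟨F, hF, hpow⟩, rfl⟩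
    refine ⟨fun y => ΓΘ.symm (F ⟨_, hmem y⟩), hcl.le ⟨F, hF, rfl⟩, fun g => ?_⟩
    exact (map_pow ΓΘ.symm _ l).symm.trans (congrArg ΓΘ.symm (hpow ⟨_, hmem' g⟩))
  · rintro ⟨F', hF', hpow'⟩
    obtain ⟨F, hF, rfl⟩ := hcl.ge hF'
    refine ⟨fun g => ΓΘ (ξ' ⟨_, hinv g⟩), ⟨F, hF, fun g => ?_⟩, ?_⟩
    · -- `(Γ_Θ ξ'(ισ⁻¹ g ισ))^l = Γ_Θ (Γ_Θ⁻¹ F(ισ (ισ⁻¹ g ισ) ισ⁻¹)) = F(g)`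
      have h1 := congrArg ΓΘ (hpow' ⟨_, hinv g⟩)
      refine (map_pow ΓΘ _ l).symm.trans (h1.trans ?_)
      exact (MulEquiv.apply_symm_apply ΓΘ _).trans (congrArg F (hrtY g))
    · funext g
      exact (MulEquiv.symm_apply_apply ΓΘ _).trans (congrArg ξ' (hrt' g))

/-! ### Orbit collections under a conjugating set stable under `σ^{±1}` -/

/-- **Transport of an orbit collection** `{classOf (s·η̈^Θ) | s ∈ S}` by `(γ_{ισ}, Γ_Θ)`: if
`σ⁻¹·S ⊆ S` and `σ·S ⊆ S` the collection is mapped onto itself. [cite: MochizukiEtTh2009, Cor 2.8(iii) p.42] -/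
theorem image_orbitColl_eq (hC : D.Compat) [hb : ε.bot.Normal] (σ : D.PiTemp)
    (ΓΘ : ε.Coeff ≃* ε.Coeff)
    (hΘ : ∀ d, ΓΘ.symm (ε.coeffOf d) = ε.coeffOf (MulAut.conjNormal (D.toTheta σ⁻¹) d))
    (hmem : ∀ y : ↥T.PiYddtp, ε.ι σ * (y : T.Gtp) * (ε.ι σ)⁻¹ ∈ T.PiYddtp) {S : Set D.PiTemp}
    (h₁ : ∀ s ∈ S, σ⁻¹ * s ∈ S) (h₂ : ∀ s ∈ S, σ * s ∈ S) :
    (fun c => (fun F : ↥T.PiYddtp → ε.Coeff => fun y : ↥T.PiYddtp => ΓΘ.symm (F ⟨_, hmem y⟩)) '' c) ''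
        ε.orbitColl hC S = ε.orbitColl hC S := by
  haveI := hC.GtpYdd_normal
  ext c
  constructor
  · rintro ⟨_, ⟨s, hs, rfl⟩, rfl⟩
    refine ⟨σ⁻¹ * s, h₁ s hs, ?_⟩
    show (fun F : ↥T.PiYddtp → ε.Coeff => fun y : ↥T.PiYddtp => ΓΘ.symm (F ⟨_, hmem y⟩)) ''
        ε.classOf (ContH1.conj D.toTheta D.DeltaTheta s E.etaDd) = _
    rw [ε.image_classOf_eq σ ΓΘ hΘ hmem, ← ContH1.conj_mul_apply]
  · rintro ⟨s, hs, rfl⟩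
    refine ⟨ε.classOf (ContH1.conj D.toTheta D.DeltaTheta (σ * s) E.etaDd), ⟨σ * s, h₂ s hs, rfl⟩, ?_⟩
    show (fun F : ↥T.PiYddtp → ε.Coeff => fun y : ↥T.PiYddtp => ΓΘ.symm (F ⟨_, hmem y⟩)) ''
        ε.classOf (ContH1.conj D.toTheta D.DeltaTheta (σ * s) E.etaDd) = _
    rw [ε.image_classOf_eq σ ΓΘ hΘ hmem, ← ContH1.conj_mul_apply, inv_mul_cancel_left]

/-- **Transport of a root-orbit collection** `{rootClassOf (s·η̈^Θ) | s ∈ S}` (`σ ∈ Π^tp_{X̲̲}`): if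
`σ⁻¹·S ⊆ S` and `σ·S ⊆ S` the collection is mapped onto itself. [cite: MochizukiEtTh2009, Cor 2.8(iii) p.42] -/
theorem image_rootColl_eq (hC : D.Compat) [hb : ε.bot.Normal] {σ : D.PiTemp} (hσ : σ ∈ C.Huu)
    (ΓΘ : ε.Coeff ≃* ε.Coeff)
    (hΘ : ∀ d, ΓΘ.symm (ε.coeffOf d) = ε.coeffOf (MulAut.conjNormal (D.toTheta σ⁻¹) d))
    (hmem : ∀ y : ↥T.PiYddtp, ε.ι σ * (y : T.Gtp) * (ε.ι σ)⁻¹ ∈ T.PiYddtp)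
    (hmem' : ∀ g : ↥(T.PiYddtp ⊓ T.tp T.PiXuu), ε.ι σ * (g : T.Gtp) * (ε.ι σ)⁻¹ ∈ T.PiYddtp ⊓ T.tp T.PiXuu)
    {S : Set D.PiTemp} (h₁ : ∀ s ∈ S, σ⁻¹ * s ∈ S) (h₂ : ∀ s ∈ S, σ * s ∈ S) :
    (fun c => (fun ξ : ↥(T.PiYddtp ⊓ T.tp T.PiXuu) → ε.Coeff => fun g : ↥(T.PiYddtp ⊓ T.tp T.PiXuu) =>
        ΓΘ.symm (ξ ⟨_, hmem' g⟩)) '' c) '' ε.rootColl hC S = ε.rootColl hC S := by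
  haveI := hC.GtpYdd_normal
  ext c
  constructor
  · rintro ⟨_, ⟨s, hs, rfl⟩, rfl⟩
    refine ⟨σ⁻¹ * s, h₁ s hs, ?_⟩
    show (fun ξ : ↥(T.PiYddtp ⊓ T.tp T.PiXuu) → ε.Coeff => fun g : ↥(T.PiYddtp ⊓ T.tp T.PiXuu) =>
        ΓΘ.symm (ξ ⟨_, hmem' g⟩)) '' ε.rootClassOf (ContH1.conj D.toTheta D.DeltaTheta s E.etaDd) = _
    rw [ε.image_rootClassOf_eq hσ ΓΘ hΘ hmem hmem', ← ContH1.conj_mul_apply]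
  · rintro ⟨s, hs, rfl⟩
    refine ⟨ε.rootClassOf (ContH1.conj D.toTheta D.DeltaTheta (σ * s) E.etaDd), ⟨σ * s, h₂ s hs, rfl⟩, ?_⟩
    show (fun ξ : ↥(T.PiYddtp ⊓ T.tp T.PiXuu) → ε.Coeff => fun g : ↥(T.PiYddtp ⊓ T.tp T.PiXuu) =>
        ΓΘ.symm (ξ ⟨_, hmem' g⟩)) '' ε.rootClassOf (ContH1.conj D.toTheta D.DeltaTheta (σ * s) E.etaDd) = _
    rw [ε.image_rootClassOf_eq hσ ΓΘ hΘ hmem hmem', ← ContH1.conj_mul_apply, inv_mul_cancel_left]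

end ThetaSetting.EtaleThetaData.DoubleUnderline.OrbitEmbedding

/-! ## Corollary 2.8 (iii), clauses 1 and 2, for `ThetaOrbitData.ofEmbedding` -/

namespace ThetaCovers.ThetaOrbitData

variable {p : ℕ} [Fact p.Prime] {D : ThetaSetting p} {E : D.EtaleThetaData} {l : ℕ}
  {C : E.DoubleUnderline l} {T : TemperedCoverData.{u} l} (ε : C.OrbitEmbedding T)

/-- **Cor 2.8 (iii), clause 1 (at `ofEmbedding`)**: "if `γ` arises from an inner automorphism of
`Π^tp_{Ẋ̲̲}`, then `γ` preserves `η̲̈^{Θ,l·ℤ}`" — for `x ∈ Π^tp_{X̲̲} ∩ Π^tp_Ċ` of `T` and `Γ_Θ` induced by the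
inner automorphism `γ_x` on the cyclotome, the transport of `η̲̈^{Θ,l·ℤ} = rootLZ` by `(γ_x, Γ_Θ)` is
`η̲̈^{Θ,l·ℤ}`. [cite: MochizukiEtTh2009, Cor 2.8(iii) p.42] -/
theorem ofEmbedding_transport_inner_rootLZ (hC : D.Compat) (hS : D.Sec2Hyps) {x : T.Gtp}
    (hx : x ∈ T.tp T.PiXuu ⊓ T.PiCdot)
    (ΓΘ : (ofEmbedding ε hC hS).DeltaTheta ≃* (ofEmbedding ε hC hS).DeltaTheta)
    (hind : (ofEmbedding ε hC hS).InducesOnTheta (innerAutTop x) ΓΘ)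
    (hYuu : (T.PiYddtp ⊓ T.tp T.PiXuu).map (innerAutTop x).toMulEquiv.toMonoidHom =
      T.PiYddtp ⊓ T.tp T.PiXuu) :
    (ofEmbedding ε hC hS).transport _ (innerAutTop x) hYuu ΓΘ (ofEmbedding ε hC hS).rootLZ =
      (ofEmbedding ε hC hS).rootLZ := by
  haveI := hC.GtpYdd_normal
  haveI : ε.bot.Normal := ε.normal_bot
  obtain ⟨σ, hσ, rfl⟩ := Subgroup.mem_map.1 (ε.map_Huu.ge (Subgroup.mem_inf.1 hx).1)
  have hdot : ε.ι σ ∈ T.PiCdot := (Subgroup.mem_inf.1 hx).2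
  have hΘ := ε.symm_coeffOf_of_induces hC hS σ ΓΘ hind
  have h₁ : ∀ s ∈ ε.dotXuu, σ⁻¹ * s ∈ ε.dotXuu := fun s hs =>
    ⟨C.Huu.mul_mem (C.Huu.inv_mem hσ) hs.1, by
      show ε.ι (σ⁻¹ * s) ∈ T.PiCdot
      rw [map_mul, map_inv]; exact T.PiCdot.mul_mem (T.PiCdot.inv_mem hdot) hs.2⟩
  have h₂ : ∀ s ∈ ε.dotXuu, σ * s ∈ ε.dotXuu := fun s hs =>
    ⟨C.Huu.mul_mem hσ hs.1, by
      show ε.ι (σ * s) ∈ T.PiCdot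
      rw [map_mul]; exact T.PiCdot.mul_mem hdot hs.2⟩
  exact ε.image_rootColl_eq hC hσ ΓΘ hΘ (ε.conj_mem_PiYddtp σ) (ε.conj_mem_PiYdduu hσ)
    (S := ε.dotXuu) h₁ h₂

/-- **Cor 2.8 (iii), clause 2 (at `ofEmbedding`)**: "if `γ` arises from an inner automorphism of `Π^tp_{Ẋ̲}`,
then `γ` preserves `η̈^{Θ,l·ℤ}`" — for `x ∈ Π^tp_{X̲} ∩ Π^tp_Ċ` of `T` and `Γ_Θ` induced by `γ_x`, the
transport of `η̈^{Θ,l·ℤ} = etaLZ` by `(γ_x, Γ_Θ)` is `η̈^{Θ,l·ℤ}`; under the identification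
`ι(Π^tp_{X̲}) = T.tp T.PiXu` of the single-underline subgroup (a further identity of the embedding, true at
abc-iut-L2-d3's model). [cite: MochizukiEtTh2009, Cor 2.8(iii) p.42] -/
theorem ofEmbedding_transport_inner_etaLZ (hC : D.Compat) (hS : D.Sec2Hyps)
    (hXu : (D.GtpXu l).map ε.ι = T.tp T.PiXu) {x : T.Gtp} (hx : x ∈ T.tp T.PiXu ⊓ T.PiCdot)
    (ΓΘ : (ofEmbedding ε hC hS).DeltaTheta ≃* (ofEmbedding ε hC hS).DeltaTheta)
    (hind : (ofEmbedding ε hC hS).InducesOnTheta (innerAutTop x) ΓΘ)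
    (hY : T.PiYddtp.map (innerAutTop x).toMulEquiv.toMonoidHom = T.PiYddtp) :
    (ofEmbedding ε hC hS).transport _ (innerAutTop x) hY ΓΘ (ofEmbedding ε hC hS).etaLZ =
      (ofEmbedding ε hC hS).etaLZ := by
  haveI := hC.GtpYdd_normal
  haveI : ε.bot.Normal := ε.normal_bot
  obtain ⟨σ, hσ, rfl⟩ := Subgroup.mem_map.1 (hXu.ge (Subgroup.mem_inf.1 hx).1)
  have hdot : ε.ι σ ∈ T.PiCdot := (Subgroup.mem_inf.1 hx).2
  have hΘ := ε.symm_coeffOf_of_induces hC hS σ ΓΘ hind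
  have h₁ : ∀ s ∈ ε.dotXu, σ⁻¹ * s ∈ ε.dotXu := fun s hs =>
    ⟨(D.GtpXu l).mul_mem ((D.GtpXu l).inv_mem hσ) hs.1, by
      show ε.ι (σ⁻¹ * s) ∈ T.PiCdot
      rw [map_mul, map_inv]; exact T.PiCdot.mul_mem (T.PiCdot.inv_mem hdot) hs.2⟩
  have h₂ : ∀ s ∈ ε.dotXu, σ * s ∈ ε.dotXu := fun s hs =>
    ⟨(D.GtpXu l).mul_mem hσ hs.1, by
      show ε.ι (σ * s) ∈ T.PiCdot
      rw [map_mul]; exact T.PiCdot.mul_mem hdot hs.2⟩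
  exact ε.image_orbitColl_eq hC σ ΓΘ hΘ (ε.conj_mem_PiYddtp σ) (S := ε.dotXu) h₁ h₂

/-- The larger collections are preserved by ALL inner automorphisms from `Π^tp_{X̲̲}`: for
`x ∈ Π^tp_{X̲̲}` of `T` and `Γ_Θ` induced by `γ_x`, `(γ_x, Γ_Θ) · η̲̈^{Θ,l·ℤ×μ₂} = η̲̈^{Θ,l·ℤ×μ₂}` (the
`Π^tp_{X̲̲}/Π^tp_{Ÿ̲̲} ≅ (l·ℤ × μ₂)`-orbit is an orbit, p.41; cf. Rmk 1.9.1). [cite: MochizukiEtTh2009, Def 2.7 p.41] -/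
theorem ofEmbedding_transport_inner_rootLZMu2 (hC : D.Compat) (hS : D.Sec2Hyps) {x : T.Gtp}
    (hx : x ∈ T.tp T.PiXuu)
    (ΓΘ : (ofEmbedding ε hC hS).DeltaTheta ≃* (ofEmbedding ε hC hS).DeltaTheta)
    (hind : (ofEmbedding ε hC hS).InducesOnTheta (innerAutTop x) ΓΘ)
    (hYuu : (T.PiYddtp ⊓ T.tp T.PiXuu).map (innerAutTop x).toMulEquiv.toMonoidHom =
      T.PiYddtp ⊓ T.tp T.PiXuu) :
    (ofEmbedding ε hC hS).transport _ (innerAutTop x) hYuu ΓΘ (ofEmbedding ε hC hS).rootLZMu2 =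
      (ofEmbedding ε hC hS).rootLZMu2 := by
  haveI := hC.GtpYdd_normal
  haveI : ε.bot.Normal := ε.normal_bot
  obtain ⟨σ, hσ, rfl⟩ := Subgroup.mem_map.1 (ε.map_Huu.ge hx)
  have hΘ := ε.symm_coeffOf_of_induces hC hS σ ΓΘ hind
  exact ε.image_rootColl_eq hC hσ ΓΘ hΘ (ε.conj_mem_PiYddtp σ) (ε.conj_mem_PiYdduu hσ)
    (S := (C.Huu : Set D.PiTemp)) (fun s hs => C.Huu.mul_mem (C.Huu.inv_mem hσ) hs)
    (fun s hs => C.Huu.mul_mem hσ hs)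

/-- Likewise `(γ_x, Γ_Θ) · η̈^{Θ,ℤ×μ₂} = η̈^{Θ,ℤ×μ₂}` for every `x ∈ ι(Π^tp_X)` (the full `Π^tp_X`-orbit, p.41;
cf. Rmk 1.9.1). [cite: MochizukiEtTh2009, Def 2.7 p.41] -/
theorem ofEmbedding_transport_inner_etaZMu2 (hC : D.Compat) (hS : D.Sec2Hyps) {x : T.Gtp}
    (hx : x ∈ (⊤ : Subgroup D.PiTemp).map ε.ι)
    (ΓΘ : (ofEmbedding ε hC hS).DeltaTheta ≃* (ofEmbedding ε hC hS).DeltaTheta)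
    (hind : (ofEmbedding ε hC hS).InducesOnTheta (innerAutTop x) ΓΘ)
    (hY : T.PiYddtp.map (innerAutTop x).toMulEquiv.toMonoidHom = T.PiYddtp) :
    (ofEmbedding ε hC hS).transport _ (innerAutTop x) hY ΓΘ (ofEmbedding ε hC hS).etaZMu2 =
      (ofEmbedding ε hC hS).etaZMu2 := by
  haveI := hC.GtpYdd_normal
  haveI : ε.bot.Normal := ε.normal_bot
  obtain ⟨σ, -, rfl⟩ := Subgroup.mem_map.1 hx
  have hΘ := ε.symm_coeffOf_of_induces hC hS σ ΓΘ hind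
  exact ε.image_orbitColl_eq hC σ ΓΘ hΘ (ε.conj_mem_PiYddtp σ) (S := Set.univ)
    (fun _ _ => Set.mem_univ _) (fun _ _ => Set.mem_univ _)

/-- **Cor 2.8 (iii), the two `X`-clauses together**, in the shape of the first two conjuncts of
`ThetaOrbitData.Cor28_iii` for `O = ofEmbedding ε hC hS` (clause 2 under `ι(Π^tp_{X̲}) = T.tp T.PiXu`).
[cite: MochizukiEtTh2009, Cor 2.8(iii) p.42] -/
theorem ofEmbedding_cor28_iii_inner (hC : D.Compat) (hS : D.Sec2Hyps)
    (hXu : (D.GtpXu l).map ε.ι = T.tp T.PiXu) (x : T.Gtp)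
    (ΓΘ : (ofEmbedding ε hC hS).DeltaTheta ≃* (ofEmbedding ε hC hS).DeltaTheta)
    (hind : (ofEmbedding ε hC hS).InducesOnTheta (innerAutTop x) ΓΘ)
    (hY : T.PiYddtp.map (innerAutTop x).toMulEquiv.toMonoidHom = T.PiYddtp)
    (hYuu : (T.PiYddtp ⊓ T.tp T.PiXuu).map (innerAutTop x).toMulEquiv.toMonoidHom =
      T.PiYddtp ⊓ T.tp T.PiXuu) :
    (x ∈ T.tp T.PiXuu ⊓ T.PiCdot →
      (ofEmbedding ε hC hS).transport _ _ hYuu ΓΘ (ofEmbedding ε hC hS).rootLZ =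
        (ofEmbedding ε hC hS).rootLZ) ∧
    (x ∈ T.tp T.PiXu ⊓ T.PiCdot →
      (ofEmbedding ε hC hS).transport _ _ hY ΓΘ (ofEmbedding ε hC hS).etaLZ =
        (ofEmbedding ε hC hS).etaLZ) :=
  ⟨fun hx => ofEmbedding_transport_inner_rootLZ ε hC hS hx ΓΘ hind hYuu,
    fun hx => ofEmbedding_transport_inner_etaLZ ε hC hS hXu hx ΓΘ hind hY⟩

end ThetaCovers.ThetaOrbitData

end Literature.AnabelianGeometry.EtaleTheta

end
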